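import Mathlib
import HarnessLib
import Summits.Ventures.LatticeQCDFlow.Exactness.NCMCGeneralSpaceRestartChainCLT
import Summits.Ventures.LatticeQCDFlow.Exactness.NCMCGeneralSpaceWilsonHeatBathBar
import Summits.Ventures.LatticeQCDFlow.Exactness.NCMCGeneralSpaceOccupancyChainSweeps

/-!
# The engine's Jarzynski lane on the torus, heat-bath / Cabibbo–Marinari sweeps between launches: the CLT of `ΔF̂_n` from EVERY initial gauge field

HONEST FRAMING: exact (Metropolis-corrected) sampling algorithms for lattice gauge theory;
figures of merit are autocorrelation/cost numbers at stated couplings and volumes; no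
continuum-physics claim.

Venture `LatticeQCDFlow` (cell pub-lqcd), topic `Exactness`; FANOUT row 13 (`eng-snf`, GEN-22).
NEW WORK of the cell, not a published result; no definition is introduced; nothing is cited as a
fact.  END-TO-END instance of GEN-22's `NCMCGeneralSpaceRestartChainCLT` (CLT of the Jarzynski
estimate along the restart chain for bounded-below work; the exactness of the printed Γ-method error
bar is the sibling file `NCMCGeneralSpaceWilsonHeatBathRestartCoverage`) — with row 9's torus Wilson single-link
heat-bath scan as the level sampler between launches (`wilson_heatBathSweep_package`, GEN-16
`NCMCGeneralSpaceWilsonHeatBathBar`: Markov, `wilsonWeight`-invariant, minorised by a non-zero finite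
measure from every configuration).  This is `latflow-snf`'s default lane `updates.sweep(…, 'hb')`
between `protocol` launches on `SU(2)` / `U(1)` (and any compact second-countable `G`).

## Content (torus Wilson theory: `G` compact second countable, `ρ` continuous, `L ≠ 0`, any `β`, `d`;
## ANY Crooks pair out of `wilsonWeight ρ β` with `e^{−ΔF} = Z₁/Z_β` and bounded-below work `−B ≤ W`;
## the heat-bath scan over an edge list visiting every edge between launches; `U₀` ANY initial field)

* **`CrooksPair.tendstoInDistribution_jarzynskiEstimate_wilsonHeatBathRestart_everyStart`** —
  `√n (ΔF̂_n − ΔF) ⇒ N(0, σ²_w / (Z₁/Z_β)²)` along the record stream launched from `U₀`.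
* §2, gauge group `SU(N)` with row 9's Cabibbo–Marinari sweep `latSweep` (the SU(3) engine's
  `lc_sweep`) between launches (`wilson_cmSweep_package`, GEN-17):
  **`CrooksPair.tendstoInDistribution_jarzynskiEstimate_wilsonCMSweepRestart_everyStart`**.

NOT CLAIMED: the coverage of the printed error bar (sibling file); unbounded work; any value of
`σ²_w`, `τ_int` or a number of ours; anything numerical.
-/

namespace Summit.Ventures.LatticeQCDFlow.Exactness.GeneralNCMC

open MeasureTheory ProbabilityTheory Set Filter Finset
open scoped ENNReal Topology

section Wilson

open Literature.MathematicalPhysics.QuantumFieldTheory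

variable {d L N : ℕ} {G : Type*} [Group G] [TopologicalSpace G] [IsTopologicalGroup G]
  (ρ : G →* Matrix (Fin N) (Fin N) ℂ) [CompactSpace G] [MeasurableSpace G] [BorelSpace G]
  [SecondCountableTopology G]

/-- **THE CLT OF THE ENGINE'S JARZYNSKI LANE FROM EVERY INITIAL GAUGE FIELD.**  Torus Wilson theory,
compact second-countable `G`, continuous `ρ`, `L ≠ 0`; ANY Crooks pair out of `wilsonWeight ρ β` with
`e^{−ΔF} = Z₁/Z_β` and bounded-below work `−B ≤ W`; the single-link heat-bath scan over an edge list
visiting every edge between launches.  For EVERY initial gauge field `U₀` and every real random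
variable `Y` with law `N(0, σ²_w / (Z₁/Z_β)²)` (`σ²_w` the Green–Kubo variance of the weights along
the record chain): `√n (ΔF̂_n − ΔF) ⇒ Y`. -/
theorem CrooksPair.tendstoInDistribution_jarzynskiEstimate_wilsonHeatBathRestart_everyStart
    [NeZero L] (hρ : Continuous ρ) (β : ℝ) {l : List (Edge d L)} (hl : ∀ ed, ed ∈ l) {E : Type*}
    [MeasurableSpace E] {ν₁ : Measure (GaugeConfig d L G)} [IsFiniteMeasure ν₁]
    {κF κR : Kernel (GaugeConfig d L G) E} [IsMarkovKernel κF] [IsMarkovKernel κR]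
    {s e : E → GaugeConfig d L G} {W : E → ℝ}
    (h : CrooksPair (wilsonWeight (d := d) (L := L) ρ β) ν₁ κF κR s e W) {ΔF : ℝ}
    (hΔF : Real.exp (-ΔF) = (((wilsonWeight (d := d) (L := L) ρ β) univ)⁻¹ * ν₁ univ).toReal)
    {B : ℝ} (hB : ∀ ω, -B ≤ W ω)
    {Ω' : Type*} [MeasurableSpace Ω'] {P' : Measure Ω'} [IsProbabilityMeasure P'] {Y : Ω' → ℝ}
    (hY : HasLaw Y (gaussianReal 0 (Real.toNNReal
      (((∫ ω, (Real.exp (-W ω) - (((wilsonWeight (d := d) (L := L) ρ β) univ)⁻¹ * ν₁ univ).toReal) ^ 2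
          ∂(fwdPathLaw (wilsonWeight (d := d) (L := L) ρ β) κF))
      + 2 * ∑' k, ∫ ω, (Real.exp (-W ω) - (((wilsonWeight (d := d) (L := L) ρ β) univ)⁻¹ * ν₁ univ).toReal)
        * (Scoring.kop ((κF ∘ₖ cycle (l.map (siteHeatBath (fun _ : Edge d L => haarProbability G)
            (gibbsDensity fun U : GaugeConfig d L G => β * wilsonAction ρ U)))).comap s
              h.measurable_s))^[k + 1]
            (fun ω => Real.exp (-W ω)
              - (((wilsonWeight (d := d) (L := L) ρ β) univ)⁻¹ * ν₁ univ).toReal) ω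
          ∂(fwdPathLaw (wilsonWeight (d := d) (L := L) ρ β) κF))
        / (((wilsonWeight (d := d) (L := L) ρ β) univ)⁻¹ * ν₁ univ).toReal ^ 2))) P') :
    ∃ (hMk : IsMarkovKernel (cycle (l.map (siteHeatBath (fun _ : Edge d L => haarProbability G)
        (gibbsDensity fun U : GaugeConfig d L G => β * wilsonAction ρ U))))),
      ∀ U₀ : GaugeConfig d L G,
        haveI := hMk
        haveI : IsProbabilityMeasure (Kernel.trajMeasure (X := fun _ : ℕ => E) (κF U₀)
            (fun n : ℕ => ((κF ∘ₖ cycle (l.map (siteHeatBath (fun _ : Edge d L => haarProbability G)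
              (gibbsDensity fun U : GaugeConfig d L G => β * wilsonAction ρ U)))).comap s
                h.measurable_s).comap
              (fun hh : (j : ↥(Finset.Iic n)) → E => hh ⟨n, Finset.mem_Iic.2 le_rfl⟩)
              (measurable_pi_apply _))) := inferInstance
        TendstoInDistribution (fun (n : ℕ) (ω : ℕ → E) =>
            Real.sqrt n * (jarzynskiEstimate (fun ε => Real.exp (-W ε)) (fun i : Fin n => ω i) - ΔF))
          atTop Y (fun _ => Kernel.trajMeasure (X := fun _ : ℕ => E) (κF U₀)
            (fun n : ℕ => ((κF ∘ₖ cycle (l.map (siteHeatBath (fun _ : Edge d L => haarProbability G)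
              (gibbsDensity fun U : GaugeConfig d L G => β * wilsonAction ρ U)))).comap s
                h.measurable_s).comap
              (fun hh : (j : ↥(Finset.Iic n)) → E => hh ⟨n, Finset.mem_Iic.2 le_rfl⟩)
              (measurable_pi_apply _))) P' := by
  obtain ⟨hMk, hfin, m, hmfin, h0, hm0, hK, hmin⟩ := wilson_heatBathSweep_package ρ hρ β hl
  haveI := hMk
  haveI := hfin
  haveI := hmfin
  exact ⟨hMk, fun U₀ =>
    h.tendstoInDistribution_jarzynskiEstimate_restartChain_everyStart _ h0 hK hΔF hm0 hmin hB U₀ hY⟩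

end Wilson

/-! ## §2 Gauge group `SU(N)`: Cabibbo–Marinari sweeps between launches -/

section CM

open Literature.MathematicalPhysics.QuantumFieldTheory

variable {n : Type*} [Fintype n] [DecidableEq n] [Nonempty n] [LinearOrder n]
variable {m : Type*} [Fintype m] [DecidableEq m]
variable {d L N : ℕ} (ρ : Matrix.specialUnitaryGroup n ℂ →* Matrix (Fin N) (Fin N) ℂ)

/-- **THE CLT OF THE SU(N) ENGINE'S JARZYNSKI LANE FROM EVERY INITIAL GAUGE FIELD** — torus Wilson
weight `wilsonWeight ρ β` on `SU(N)`, `ρ` continuous, `L ≠ 0`; ANY Crooks pair out of it with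
`e^{−ΔF} = Z₁/Z_β` and `−B ≤ W`; row 9's Cabibbo–Marinari sweep (frames listing the coordinate pairs
lexicographically or reversed, a link list visiting every edge) between launches.  For EVERY initial
gauge field `U₀` and every `Y ~ N(0, σ²_w / (Z₁/Z_β)²)`: `√n (ΔF̂_n − ΔF) ⇒ Y`. -/
theorem CrooksPair.tendstoInDistribution_jarzynskiEstimate_wilsonCMSweepRestart_everyStart [NeZero L]
    (hρ : Continuous ρ) (β : ℝ) (frames : List (n ≃ Fin 2 ⊕ m))
    (hlex : frames.map pairOf = lexPairs (Finset.univ.sort (· ≤ ·) : List n) ∨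
      frames.map pairOf = (lexPairs (Finset.univ.sort (· ≤ ·) : List n)).reverse)
    {links : List (Edge d L)} (hl : ∀ ed, ed ∈ links) {E : Type*} [MeasurableSpace E]
    {ν₁ : Measure (GaugeConfig d L (Matrix.specialUnitaryGroup n ℂ))} [IsFiniteMeasure ν₁]
    {κF κR : Kernel (GaugeConfig d L (Matrix.specialUnitaryGroup n ℂ)) E} [IsMarkovKernel κF]
    [IsMarkovKernel κR] {s e : E → GaugeConfig d L (Matrix.specialUnitaryGroup n ℂ)} {W : E → ℝ}
    (h : CrooksPair (wilsonWeight (d := d) (L := L) ρ β) ν₁ κF κR s e W) {ΔF : ℝ}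
    (hΔF : Real.exp (-ΔF) = (((wilsonWeight (d := d) (L := L) ρ β) univ)⁻¹ * ν₁ univ).toReal)
    {B : ℝ} (hB : ∀ ω, -B ≤ W ω)
    {Ω' : Type*} [MeasurableSpace Ω'] {P' : Measure Ω'} [IsProbabilityMeasure P'] {Y : Ω' → ℝ}
    (hY : HasLaw Y (gaussianReal 0 (Real.toNNReal
      (((∫ ω, (Real.exp (-W ω) - (((wilsonWeight (d := d) (L := L) ρ β) univ)⁻¹ * ν₁ univ).toReal) ^ 2
          ∂(fwdPathLaw (wilsonWeight (d := d) (L := L) ρ β) κF))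
      + 2 * ∑' k, ∫ ω, (Real.exp (-W ω) - (((wilsonWeight (d := d) (L := L) ρ β) univ)⁻¹ * ν₁ univ).toReal)
        * (Scoring.kop ((κF ∘ₖ latSweep (gibbsDensity fun U : GaugeConfig d L
            (Matrix.specialUnitaryGroup n ℂ) => β * wilsonAction ρ U) frames links).comap s
              h.measurable_s))^[k + 1]
            (fun ω => Real.exp (-W ω)
              - (((wilsonWeight (d := d) (L := L) ρ β) univ)⁻¹ * ν₁ univ).toReal) ω
          ∂(fwdPathLaw (wilsonWeight (d := d) (L := L) ρ β) κF))
        / (((wilsonWeight (d := d) (L := L) ρ β) univ)⁻¹ * ν₁ univ).toReal ^ 2))) P') :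
    ∃ (hMk : IsMarkovKernel (latSweep (gibbsDensity fun U : GaugeConfig d L
        (Matrix.specialUnitaryGroup n ℂ) => β * wilsonAction ρ U) frames links)),
      ∀ U₀ : GaugeConfig d L (Matrix.specialUnitaryGroup n ℂ),
        haveI := hMk
        haveI : IsProbabilityMeasure (Kernel.trajMeasure (X := fun _ : ℕ => E) (κF U₀)
            (fun k : ℕ => ((κF ∘ₖ latSweep (gibbsDensity fun U : GaugeConfig d L
              (Matrix.specialUnitaryGroup n ℂ) => β * wilsonAction ρ U) frames links).comap s
                h.measurable_s).comap
              (fun hh : (j : ↥(Finset.Iic k)) → E => hh ⟨k, Finset.mem_Iic.2 le_rfl⟩)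
              (measurable_pi_apply _))) := inferInstance
        TendstoInDistribution (fun (k : ℕ) (ω : ℕ → E) =>
            Real.sqrt k * (jarzynskiEstimate (fun ε => Real.exp (-W ε)) (fun i : Fin k => ω i) - ΔF))
          atTop Y (fun _ => Kernel.trajMeasure (X := fun _ : ℕ => E) (κF U₀)
            (fun k : ℕ => ((κF ∘ₖ latSweep (gibbsDensity fun U : GaugeConfig d L
              (Matrix.specialUnitaryGroup n ℂ) => β * wilsonAction ρ U) frames links).comap s
                h.measurable_s).comap
              (fun hh : (j : ↥(Finset.Iic k)) → E => hh ⟨k, Finset.mem_Iic.2 le_rfl⟩)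
              (measurable_pi_apply _))) P' := by
  obtain ⟨hMk, hfin, mm, hmfin, h0, hm0, hK, hmin⟩ := wilson_cmSweep_package ρ hρ β frames hlex hl
  haveI := hMk
  haveI := hfin
  haveI := hmfin
  exact ⟨hMk, fun U₀ =>
    h.tendstoInDistribution_jarzynskiEstimate_restartChain_everyStart _ h0 hK hΔF hm0 hmin hB U₀ hY⟩

end CM

end Summit.Ventures.LatticeQCDFlow.Exactness.GeneralNCMC
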